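import Summits.RiemannHypothesis.RiemannHypothesis.Theorems.GroundBartaEvenWinsBeyondArchDeflationRM75ZFinalA
import Summits.RiemannHypothesis.RiemannHypothesis.Theorems.GroundBartaEvenWinsBeyondArchDeflationM75Final
import HarnessLib

/-!
# RiemannHypothesis / GroundBarta — rung 4 (`EvenWinsBeyondArch`): R-layer certificate of cell M75Y — bridge to prover A's `m75v` / `m75F`

Prover B (speedrun unit `sr-gb-rung-b`, gen 4).  The certified residual norms `z75hs0 … z75hs5` (file `…RM75ZFinalA`) restated
for prover A's trial vectors `m75v i = dt_wY (m75P i) (3/4)` and window images `m75F` (file `…M75Final`), i.e. exactly the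
hypothesis `hs` of `dt_m75_oddLower_of_sigma` with `W = z75Wsig`, `s i = z75s i`:
`∀ i, ∫ ‖m75F i − Σ_l z75Wsig i l • m75v l‖² ≤ z75s i`.  The only content is `z75Pf = m75P` (the same dyadic lists) — `rfl`.
-/

set_option linter.dupNamespace false

noncomputable section

open MeasureTheory Set Filter intervalIntegral
open scoped Topology BigOperators

namespace Summit.RiemannHypothesis.RiemannHypothesis.Theorems.EvenWinsBeyondArch

open Literature.NumberTheory.LFunctions
open Literature.Analysis.ValidatedNumerics Literature.Analysis.ValidatedNumerics.PolyMP

/-- The coefficient matrix of the sigma criterion: `W_il = W̃_il + [l = i] (M̃ − M_{3/4})`. -/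
def z75Wsig : Fin 6 → Fin 6 → ℝ := fun i l ↦
  (z75Wd i l : ℝ) + if l = i then (z75Mc : ℝ) - weilMarkovConstant ((3 : ℝ) / 4) else 0

/-- Prover A's and prover B's copies of the six dyadic vectors are the same lists. -/
theorem z75Pf_eq_m75P : z75Pf = m75P := by
  funext i
  fin_cases i <;> rfl

/-- `m75v l` is the window vector of the certificate. -/
theorem m75v_eq_z75 (l : Fin 6) : m75v l = dt_wY (z75Pf l) z75c := by
  rw [z75Pf_eq_m75P]; rfl

/-- **The residual bounds in prover A's vocabulary** (hypothesis `hs` of `dt_m75_oddLower_of_sigma` with `W := z75Wsig`,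
`s i := z75s i`). [cite: Bombieri2000Weil, Thm 2] -/
theorem z75hs_m75 : ∀ i : Fin 6, ∫ x, ‖(m75F i - ∑ l, z75Wsig i l • m75v l) x‖ ^ 2 ≤ ((z75s i : ℚ) : ℝ) := by
  have hF : ∀ l y, m75F l y = (Icc (-((3 : ℝ) / 4)) ((3 : ℝ) / 4)).indicator (fun y ↦
        2 * (∫ x, dt_wY (z75Pf l) z75c x * (Real.cosh (x / 2) : ℂ)) * (Real.cosh (y / 2) : ℂ) -
          2 * (∫ x, dt_wY (z75Pf l) z75c x * (Real.sinh (x / 2) : ℂ)) * (Real.sinh (y / 2) : ℂ) +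
        (∑ n ∈ weilPrimeIndex ((3 : ℝ) / 4), (((ArithmeticFunction.vonMangoldt n : ℝ) / Real.sqrt n : ℝ) : ℂ) *
          (2 * dt_wY (z75Pf l) z75c y - dt_wY (z75Pf l) z75c (y - Real.log n) - dt_wY (z75Pf l) z75c (y + Real.log n))) +
        ∫ t in Ioi 0, (weilArchDensity t : ℂ) * (2 * dt_wY (z75Pf l) z75c y - dt_wY (z75Pf l) z75c (y - t) - dt_wY (z75Pf l) z75c (y + t))) y -
      (weilMarkovConstant ((3 : ℝ) / 4) : ℂ) * dt_wY (z75Pf l) z75c y := by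
    intro l y
    simp only [m75F, m75v_eq_z75]
  have hW : ∀ i, (fun l ↦ z75Wsig i l • m75v l) =
      fun l ↦ ((z75Wd i l : ℝ) + if l = i then (z75Mc : ℝ) - weilMarkovConstant ((3 : ℝ) / 4) else 0) • dt_wY (z75Pf l) z75c := by
    intro i; funext l; rw [m75v_eq_z75]; rfl
  intro i
  fin_cases i
  · simp only [hW]; exact z75hs0 m75F hF
  · simp only [hW]; exact z75hs1 m75F hF
  · simp only [hW]; exact z75hs2 m75F hF
  · simp only [hW]; exact z75hs3 m75F hF
  · simp only [hW]; exact z75hs4 m75F hF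
  · simp only [hW]; exact z75hs5 m75F hF

end Summit.RiemannHypothesis.RiemannHypothesis.Theorems.EvenWinsBeyondArch

end
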